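import Literature.AlgebraicGeometry.Modules.PushforwardInjectiveResolution
import Literature.AlgebraicGeometry.Modules.ExtCohomologyComparison
import Literature.Algebra.Homology.HomotopyOrthogonalOfExtVanishing
import Literature.Algebra.Homology.KInjectiveAdjunction
import HarnessLib

/-!
# The derived adjunction `Hom_{D(X)}(g^*M•, E•⟦k⟧) ≅ Hom_{D(Y)}(M•, g_*E•⟦k⟧)` along an AFFINE morphism,
# for bounded complexes of vector bundles — WITHOUT flatness of `g`
# (Lipman Prop. 3.2.3 / Stacks 0DVC on the resolution model; Hartshorne III.6.7, III.8.1)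

Let `g : X → Y` be an affine morphism of schemes, `M•` a BOUNDED complex of finite locally free
`𝒪_Y`-modules and `E•` a bounded-below complex of finite locally free `𝒪_X`-modules. Then for every
`k : ℤ` there is a linear isomorphism

  `Hom_{D(Mod 𝒪_X)}(Q(g^*M•), (Q E•)⟦k⟧) ≃ₗ[𝕜] Hom_{D(Mod 𝒪_Y)}(Q M•, (Q g_*E•)⟦k⟧)`

(`shiftedHomLinearEquivPullbackPushforwardOfVectorBundles`), `g^*`, `g_*` the termwise pull-back ∕
direct image (Mathlib `Scheme.Modules.pullback ∕ pushforward`), `Q` the localisation functor of Mathlib's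
derived category, `𝕜` any ring for which `g_*` is `𝕜`-linear (e.g. the base field of `k`-schemes,
`Modules/PushforwardLinear`). This is the derived adjunction `Lg^* ⊣ Rg_*` of the literature evaluated
on complexes where `Rg_*E• = g_*E•` (Leray: `g` affine, `Eⁿ` quasi-coherent) — but proved WITHOUT the
exactness of `g^*` (no flatness, no derived functor of `g^*` is asserted; `Q(g^*M•)` is the termwise
pull-back) by the K-injective ∕ acyclic-target route:

  `Hom_D(Q g^*M•, Q E•⟦k⟧) = Hom_D(Q g^*M•, Q I•⟦k⟧)`      (`E• → I•` injective resolution)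
  `= Hom_K(g^*M•, I•⟦k⟧)`                                 (`I•⟦k⟧` K-injective)
  `= Hom_K(M•, g_*I•⟦k⟧)`                                  (termwise adjunction on homotopy classes,
                                                             `Algebra/Homology/KInjectiveAdjunction`)
  `= Hom_D(Q M•, Q g_*I•⟦k⟧)`                              (`Mᵖ` vector bundles, `g_*Iⁿ` has flasque
                                                             `𝓗om(Mᵖ, –)`: `Extⁱ(Mᵖ, g_*Iⁿ) = 0`, so
                                                             `Algebra/Homology/HomotopyOrthogonalOfExtVanishing`)
  `= Hom_D(Q M•, Q g_*E•⟦k⟧)`                              (Leray: `g_*E• → g_*I•` quasi-iso,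
                                                             `Modules/PushforwardInjectiveResolution`).

The fourth step is where a general `M•` would need `g_*Iⁿ` injective, i.e. `g^*` exact (flat `g`);
for vector-bundle `M•` the flasqueness of `𝓗om(Mᵖ, g_*Iⁿ)` suffices.

* `isFlasque_toSheaf_pushforward` — `g_*` of a module with flasque underlying sheaf is flasque;
* `subsingleton_ext_pushforward_succ_of_injective` — **`Extⁿ⁺¹(F, g_*I) = 0`** for `F` finite locally free,
  `I` injective (III.6.7: `= Hⁿ⁺¹(Y, 𝓗om(F, g_*I))`, a flasque sheaf);
* `shiftedHomLinearEquivPullbackPushforwardOfInjective` — the adjunction isomorphism on an injective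
  bounded-below `I•` for bounded vector-bundle `M•`;
* `shiftedHomLinearEquivPullbackPushforwardOfVectorBundles` — **the derived adjunction for `M•`, `E•`
  bounded(-below) complexes of vector bundles along an affine `g`.**

Everything is proved; no named facts. Written for Road №4 of the Hodge atlas (piece (R) ∕ (Adj)
`PullbackPushforwardExtAdjunction` of crux stmt-HodgeConjecture-26512, at `M• := g_*E•`).

## References

* J. Lipman, *Notes on derived functors and Grothendieck duality*, LNM 1960 (2009), Prop. 3.2.3.
  [Lipman2009]
* The Stacks Project, Tag 0DVC (derived adjunction), Tag 01XC (affine morphisms). [StacksProject]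
* R. Hartshorne, *Algebraic Geometry*, GTM 52 (1977), II §5 p. 110 (`f^* ⊣ f_*`), III Prop. 6.7,
  III Prop. 8.1. [Hartshorne1977]
* R. Godement, *Topologie algébrique et théorie des faisceaux* (1958), II Thm. 3.1.2. [Godement1958]
-/

noncomputable section

-- `TopCat.Presheaf`/`Scheme.Modules` are not reducible (as in Mathlib's `AlgebraicGeometry/Modules/Sheaf.lean`).
set_option backward.isDefEq.respectTransparency false

open CategoryTheory CategoryTheory.Limits CategoryTheory.Abelian AlgebraicGeometry Opposite
  TopologicalSpace
open Literature.Algebra.Homology Literature.AlgebraicGeometry.Motives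
  Literature.AlgebraicGeometry.HodgeTheory

universe w w' v u

namespace Literature.AlgebraicGeometry.Modules

variable {X Y : Scheme.{u}} (g : X ⟶ Y)

/-! ### `Extⁱ(F, g_*I) = 0` for `F` a vector bundle and `I` injective -/

section ExtPushforward

/-- The direct image of an `𝒪_X`-module with flasque underlying sheaf has flasque underlying sheaf
(its restriction maps are restriction maps of the original). [cite: Hartshorne1977, II Ex. 1.16 (d)] -/
theorem isFlasque_toSheaf_pushforward (I : X.Modules)
    [TopCat.Sheaf.IsFlasque ((SheafOfModules.toSheaf X.ringCatSheaf).obj I)] :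
    TopCat.Sheaf.IsFlasque ((SheafOfModules.toSheaf Y.ringCatSheaf).obj
      ((Scheme.Modules.pushforward g).obj I)) where
  epi {U V} i := by
    change Epi (I.presheaf.map ((Opens.map g.base).map i.unop).op)
    exact TopCat.Presheaf.IsFlasque.epi (F := ((SheafOfModules.toSheaf X.ringCatSheaf).obj I).obj) _

/-- **`Extⁿ⁺¹_{𝒪_Y}(F, g_*I) = 0` for `F` finite locally free on `Y` and `I` an injective `𝒪_X`-module**,
for ANY morphism `g`: by Hartshorne III.6.7 `Extⁱ(F, g_*I) ≅ Hⁱ(Y, 𝓗om(F, g_*I))`, and `𝓗om(F, g_*I)` is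
flasque (`g_*I` is flasque as `I` is; Godement II 3.1.2 / `Modules/SheafHomFlasque`), hence acyclic
(III.2.5). [cite: Hartshorne1977, III Prop. 6.7 and Prop. 2.5] [cite: Godement1958, II Thm. 3.1.2] -/
theorem subsingleton_ext_pushforward_succ_of_injective [HasExt.{w} Y.Modules] {F : Y.Modules}
    (hF : IsFiniteLocallyFree F) (I : X.Modules) [Injective I] (n : ℕ) :
    Subsingleton (Ext.{w} F ((Scheme.Modules.pushforward g).obj I) (n + 1)) := by
  haveI := isFlasque_of_injective_modules I
  haveI := isFlasque_toSheaf_pushforward g I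
  haveI : TopCat.Sheaf.IsFlasque ((modulesToSheaf Y).obj
      (sheafHom F ((Scheme.Modules.pushforward g).obj I))) :=
    isFlasque_sheafHom hF ((Scheme.Modules.pushforward g).obj I)
  haveI : Subsingleton (((modulesToSheaf Y).obj
      (sheafHom F ((Scheme.Modules.pushforward g).obj I))).H (n + 1)) :=
    subsingleton_H_of_isFlasque _ (n + 1) (by omega)
  exact subsingleton_ext_of_subsingleton_H_sheafHom hF _ (n + 1)

end ExtPushforward

/-! ### The derived adjunction on vector-bundle complexes -/

section Adjunction

variable {𝕜 : Type*} [Ring 𝕜] [Linear 𝕜 X.Modules] [Linear 𝕜 Y.Modules]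
  [(Scheme.Modules.pushforward g).Linear 𝕜]
  [HasDerivedCategory.{w} X.Modules] [HasDerivedCategory.{w'} Y.Modules]

/-- **The adjunction isomorphism on an injective target**: for ANY morphism `g`, `M•` a bounded complex of
finite locally free `𝒪_Y`-modules and `I•` a bounded-below complex of injective `𝒪_X`-modules,
`Hom_{D(X)}(Q(g^*M•), (Q I•)⟦k⟧) ≃ₗ[𝕜] Hom_{D(Y)}(Q M•, (Q g_*I•)⟦k⟧)`: `I•⟦k⟧` is K-injective, the termwise
adjunction identifies homotopy classes, and `Hom_K(M•, g_*I•⟦k⟧) = Hom_D(Q M•, Q g_*I•⟦k⟧)` because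
`Extⁱ(Mᵖ, g_*Iⁿ) = 0` (`subsingleton_ext_pushforward_succ_of_injective`). No flatness of `g` is used.
[cite: Lipman2009, Prop. 3.2.3] [cite: StacksProject, Tag 0DVC] [cite: Hartshorne1977, II §5 p. 110 and III Prop. 6.7] -/
def shiftedHomLinearEquivPullbackPushforwardOfInjective (M : CochainComplex Y.Modules ℤ) (a₀ b₀ : ℤ)
    (hMa : ∀ p, p < a₀ → IsZero (M.X p)) (hMb : ∀ p, b₀ ≤ p → IsZero (M.X p))
    (hM : ∀ p, IsFiniteLocallyFree (M.X p)) (I : CochainComplex X.Modules ℤ) (a : ℤ)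
    [I.IsStrictlyGE a] [∀ n, Injective (I.X n)] (k : ℤ) :
    ShiftedHom (DerivedCategory.Q.obj (((Scheme.Modules.pullback g).mapHomologicalComplex
        (ComplexShape.up ℤ)).obj M)) (DerivedCategory.Q.obj I) k ≃ₗ[𝕜]
      ShiftedHom (DerivedCategory.Q.obj M) (DerivedCategory.Q.obj
        (((Scheme.Modules.pushforward g).mapHomologicalComplex (ComplexShape.up ℤ)).obj I)) k := by
  letI : HasExt.{w'} Y.Modules := hasExt_of_hasDerivedCategory Y.Modules
  haveI : I.IsKInjective := CochainComplex.isKInjective_of_injective I a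
  haveI : CochainComplex.IsKInjective (I⟦k⟧) := inferInstance
  let R := (Scheme.Modules.pushforward g).mapHomologicalComplex (ComplexShape.up ℤ)
  -- `Hom_K(M, g_*(I⟦k⟧)) = Hom_D(Q M, Q g_*(I⟦k⟧))`: the terms `g_*Iⁿ⁺ᵏ` have flasque `𝓗om(Mᵖ, –)`
  have hN : ∀ n, n < a - k → IsZero ((R.obj (I⟦k⟧)).X n) := fun n hn =>
    (Scheme.Modules.pushforward g).map_isZero (I.isZero_of_isStrictlyGE a (n + k) (by omega))
  have hX : ∀ (p n : ℤ) (i : ℕ), 1 ≤ i → Subsingleton (Ext (M.X p) ((R.obj (I⟦k⟧)).X n) i) := by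
    intro p n i hi
    obtain ⟨j, rfl⟩ := Nat.exists_eq_add_one_of_ne_zero (by omega : i ≠ 0)
    exact subsingleton_ext_pushforward_succ_of_injective g (hM p) (I.X (n + k)) j
  exact (shiftedHomQLinearEquiv _ I k).trans <|
    ((IsKInjective.homLinearEquivQ _ (I⟦k⟧)).symm.trans <|
      (homotopyHomEquivOfAdjunction (Scheme.Modules.pullbackPushforwardAdjunction g)
          (ComplexShape.up ℤ) M (I⟦k⟧)).trans <|
        (homLinearEquivQOfExtVanishing (a - k) hN a₀ b₀ hMa hMb hX).trans <|
          (Linear.homCongr 𝕜 (Iso.refl _) (DerivedCategory.Q.mapIso ((R.commShiftIso k).app I))).trans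
            (shiftedHomQLinearEquiv M _ k).symm)

variable [IsAffineHom g]

/-- **The derived adjunction along an AFFINE morphism for complexes of vector bundles**: `M•` a bounded
complex of finite locally free `𝒪_Y`-modules, `E•` a bounded-below complex of finite locally free
`𝒪_X`-modules, `k : ℤ`:
`Hom_{D(Mod 𝒪_X)}(Q(g^*M•), (Q E•)⟦k⟧) ≃ₗ[𝕜] Hom_{D(Mod 𝒪_Y)}(Q M•, (Q g_*E•)⟦k⟧)`.
Choose an injective resolution `E• → I•` (enough injectives in `Mod 𝒪_X`); `g_*E• → g_*I•` is a
quasi-isomorphism by Leray's acyclicity lemma for the affine `g` (`Rg_*E• = g_*E•`, Hartshorne III.8.1 /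
Stacks 01XC); transport `shiftedHomLinearEquivPullbackPushforwardOfInjective` along the two
quasi-isomorphisms. No flatness of `g` is used.
[cite: Lipman2009, Prop. 3.2.3] [cite: StacksProject, Tag 0DVC and Tag 01XC] [cite: Hartshorne1977, III Prop. 8.1 and III Prop. 6.7] -/
def shiftedHomLinearEquivPullbackPushforwardOfVectorBundles (M : CochainComplex Y.Modules ℤ)
    (a₀ b₀ : ℤ) (hMa : ∀ p, p < a₀ → IsZero (M.X p)) (hMb : ∀ p, b₀ ≤ p → IsZero (M.X p))
    (hM : ∀ p, IsFiniteLocallyFree (M.X p)) (E : CochainComplex X.Modules ℤ) (a : ℤ)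
    (hEa : ∀ n, n < a → IsZero (E.X n)) (hE : ∀ n, IsFiniteLocallyFree (E.X n)) (k : ℤ) :
    ShiftedHom (DerivedCategory.Q.obj (((Scheme.Modules.pullback g).mapHomologicalComplex
        (ComplexShape.up ℤ)).obj M)) (DerivedCategory.Q.obj E) k ≃ₗ[𝕜]
      ShiftedHom (DerivedCategory.Q.obj M) (DerivedCategory.Q.obj
        (((Scheme.Modules.pushforward g).mapHomologicalComplex (ComplexShape.up ℤ)).obj E)) k := by
  haveI : E.IsStrictlyGE a := (CochainComplex.isStrictlyGE_iff E a).mpr (fun i hi => hEa i hi)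
  let hres := CochainComplex.Plus.modelCategoryQuillen.exists_quasiIso_injective E a
  let I := hres.choose
  let ι : E ⟶ I := hres.choose_spec.choose
  haveI hι : QuasiIso ι := hres.choose_spec.choose_spec.choose
  haveI hI : ∀ n, Injective (I.X n) := hres.choose_spec.choose_spec.choose_spec.choose
  haveI hIa : I.IsStrictlyGE a := hres.choose_spec.choose_spec.choose_spec.choose_spec
  let R := (Scheme.Modules.pushforward g).mapHomologicalComplex (ComplexShape.up ℤ)
  -- Leray: `g_*ι` is a quasi-isomorphism
  have hR : QuasiIso (R.map ι) :=
    quasiIso_pushforward_map_of_injective_of_isFiniteLocallyFree g ι a hEa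
      (fun n hn => I.isZero_of_isStrictlyGE a n hn) hE hI
  haveI : IsIso (DerivedCategory.Q.map ι) := by
    rw [DerivedCategory.isIso_Q_map_iff_quasiIso]; infer_instance
  haveI : IsIso (DerivedCategory.Q.map (R.map ι)) := by
    rw [DerivedCategory.isIso_Q_map_iff_quasiIso]; exact hR
  exact (Linear.homCongr 𝕜 (Iso.refl _)
      ((shiftFunctor (DerivedCategory X.Modules) k).mapIso (asIso (DerivedCategory.Q.map ι)))).trans <|
    (shiftedHomLinearEquivPullbackPushforwardOfInjective g M a₀ b₀ hMa hMb hM I a k).trans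
      (Linear.homCongr 𝕜 (Iso.refl _) ((shiftFunctor (DerivedCategory Y.Modules) k).mapIso
        (asIso (DerivedCategory.Q.map (R.map ι))))).symm

end Adjunction

end Literature.AlgebraicGeometry.Modules

end
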